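import Mathlib
import HarnessLib

/-!
# Crux `NewtonUnitEquations.DissociatedUniform` (stmt-ValiantsHypothesis-5905), `n = 3` totals law of model (Q**):
# PATTERN PAIRS and the record sweep — the combinatorial half of the staircase hull bound

Bookkeeping for `…TotalsLawStaircase` (the bound `#vert conv {v i + b j : ρ i < γ j} ≤ 4·(#rows + #columns)`).
Rows `i` carry positions `ρ i ∈ ℕ`, columns `j` positions `γ j ∈ ℕ`.  For a row label set `A` and a column label set `B`,
the PATTERN PAIRS `patt ρ γ A B` are the pairs `(i, j) ∈ A × B` with `ρ i < γ j` and no label of either kind strictly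
between.  They are pairwise separated (`patt_sep`), hence at most `#A` at a time (`card_patt_le`); when the label sets
change, every new pattern pair owns an EVENT (an appearing or disappearing label inside its range, `exists_event`),
injectively (`card_sdiff_patt_le`).  If, along a real parameter, each label's membership is an interval of times, every
label appears at most once and disappears at most once, and a potential argument over any finite set of times bounds the
number of pattern pairs ever formed by `2·(#rows + #columns)` (`card_biUnion_patt_le`).  In `…TotalsLawStaircase` the
labels are the chart records of the two point families and every hull vertex of the staircase sum yields a pattern pair.
Honest label: finite combinatorics; nothing here bears on VP ≠ VNP. [folklore]
-/

set_option linter.dupNamespace false -- `ValiantsHypothesis.ValiantsHypothesis` (summit = problem) in every name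

open Finset

namespace Summit.ValiantsHypothesis.ValiantsHypothesis.Theorems.NewtonUnitEquationsDissociatedUniform

namespace TotalsLaw

namespace Stair

variable {ι κ : Type*} {ρ : ι → ℕ} {γ : κ → ℕ}

/-! ### Pattern pairs of two label sets -/

section Pattern

variable (ρ γ) in
/-- The PATTERN PAIRS of a row label set `A` and a column label set `B`: pairs `(i, j) ∈ A × B` with `ρ i < γ j` and no
label of either kind at a position strictly between. -/
def patt (A : Finset ι) (B : Finset κ) : Finset (ι × κ) :=
  (A ×ˢ B).filter fun p => ρ p.1 < γ p.2 ∧ (∀ k ∈ A, ¬(ρ p.1 < ρ k ∧ ρ k < γ p.2)) ∧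
    (∀ k ∈ B, ¬(ρ p.1 < γ k ∧ γ k < γ p.2))

/-- Membership in `patt`. [folklore] -/
theorem mem_patt {A : Finset ι} {B : Finset κ} {p : ι × κ} :
    p ∈ patt ρ γ A B ↔ p.1 ∈ A ∧ p.2 ∈ B ∧ ρ p.1 < γ p.2 ∧ (∀ k ∈ A, ¬(ρ p.1 < ρ k ∧ ρ k < γ p.2)) ∧
      (∀ k ∈ B, ¬(ρ p.1 < γ k ∧ γ k < γ p.2)) := by
  simp only [patt, Finset.mem_filter, Finset.mem_product, and_assoc]

/-- **Separation.** Two distinct pattern pairs occupy disjoint position ranges. [folklore] -/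
theorem patt_sep (hρ : Function.Injective ρ) (hγ : Function.Injective γ) {A : Finset ι} {B : Finset κ}
    {p p' : ι × κ} (hp : p ∈ patt ρ γ A B) (hp' : p' ∈ patt ρ γ A B) (hne : p ≠ p') :
    γ p.2 ≤ ρ p'.1 ∨ γ p'.2 ≤ ρ p.1 := by
  rw [mem_patt] at hp hp'
  obtain ⟨h1, h2, h3, h4, h5⟩ := hp
  obtain ⟨h1', h2', h3', h4', h5'⟩ := hp'
  rcases lt_trichotomy (ρ p.1) (ρ p'.1) with h | h | h
  · left
    by_contra hc
    exact h4 p'.1 h1' ⟨h, lt_of_not_ge hc⟩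
  · have hr : p.1 = p'.1 := hρ h
    rcases lt_trichotomy (γ p.2) (γ p'.2) with k | k | k
    · exact absurd ⟨by rw [← h]; exact h3, k⟩ (h5' p.2 h2)
    · exact absurd (Prod.ext hr (hγ k)) hne
    · exact absurd ⟨by rw [h]; exact h3', k⟩ (h5 p'.2 h2')
  · right
    by_contra hc
    exact h4' p.1 h1 ⟨h, lt_of_not_ge hc⟩

/-- Pattern pairs have pairwise distinct rows, so there are at most `#A` of them. [folklore] -/
theorem card_patt_le (hρ : Function.Injective ρ) (hγ : Function.Injective γ) (A : Finset ι) (B : Finset κ) :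
    (patt ρ γ A B).card ≤ A.card := by
  classical
  calc (patt ρ γ A B).card = ((patt ρ γ A B).image Prod.fst).card := by
        refine (Finset.card_image_of_injOn fun p hp p' hp' h => ?_).symm
        by_contra hne
        have h3 := (mem_patt.1 (Finset.mem_coe.1 hp)).2.2.1
        have h3' := (mem_patt.1 (Finset.mem_coe.1 hp')).2.2.1
        rcases patt_sep hρ hγ (Finset.mem_coe.1 hp) (Finset.mem_coe.1 hp') hne with k | k
        · rw [h] at h3; omega
        · rw [h] at k; omega
    _ ≤ A.card := Finset.card_le_card fun r hr => by
        obtain ⟨p, hp, rfl⟩ := Finset.mem_image.1 hr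
        exact (mem_patt.1 hp).1

/-- The EVENTS between two label states `(A, B) → (A', B')`, coded by position and type:
`0` = a row label appears, `1` = a row label disappears, `2`/`3` = the same for columns. -/
def events [DecidableEq ι] [DecidableEq κ] (ρ : ι → ℕ) (γ : κ → ℕ) (A A' : Finset ι) (B B' : Finset κ) :
    Finset (ℕ × ℕ) :=
  ((A' \ A).image fun r => (ρ r, 0)) ∪ ((A \ A').image fun r => (ρ r, 1)) ∪
    (((B' \ B).image fun c => (γ c, 2)) ∪ ((B \ B').image fun c => (γ c, 3)))

/-- The number of events is at most the number of changed labels. [folklore] -/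
theorem card_events_le [DecidableEq ι] [DecidableEq κ] (A A' : Finset ι) (B B' : Finset κ) :
    (events ρ γ A A' B B').card ≤ (A' \ A).card + (A \ A').card + ((B' \ B).card + (B \ B').card) := by
  unfold events
  refine (Finset.card_union_le _ _).trans (add_le_add ?_ ?_)
  · exact (Finset.card_union_le _ _).trans (add_le_add Finset.card_image_le Finset.card_image_le)
  · exact (Finset.card_union_le _ _).trans (add_le_add Finset.card_image_le Finset.card_image_le)

/-- **New pattern pairs own an event**: a pattern pair `p` of the new state that is not one of the old state OWNS an
event `e = (position, type)` — the position lies in `[ρ p.1, γ p.2)` for a row event and in `(ρ p.1, γ p.2]` for a column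
event. [folklore] -/
theorem exists_event [DecidableEq ι] [DecidableEq κ] {A A' : Finset ι} {B B' : Finset κ} {p : ι × κ}
    (hp' : p ∈ patt ρ γ A' B') (hp : p ∉ patt ρ γ A B) : ∃ e ∈ events ρ γ A A' B B',
      ρ p.1 ≤ e.1 ∧ e.1 ≤ γ p.2 ∧ (e.2 ≤ 1 → e.1 < γ p.2) ∧ (2 ≤ e.2 → ρ p.1 < e.1) := by
  rw [mem_patt] at hp'
  obtain ⟨h1, h2, h3, h4, h5⟩ := hp'
  simp only [events, Finset.mem_union, Finset.mem_image, Finset.mem_sdiff]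
  by_cases ha : p.1 ∈ A
  swap
  · exact ⟨(ρ p.1, 0), Or.inl (Or.inl ⟨p.1, ⟨h1, ha⟩, rfl⟩), le_rfl, h3.le, fun _ => h3, fun h => by omega⟩
  by_cases hb : p.2 ∈ B
  swap
  · exact ⟨(γ p.2, 2), Or.inr (Or.inl ⟨p.2, ⟨h2, hb⟩, rfl⟩), h3.le, le_rfl, fun h => by omega, fun _ => h3⟩
  by_cases hA : ∀ k ∈ A, ¬(ρ p.1 < ρ k ∧ ρ k < γ p.2)
  swap
  · push Not at hA
    obtain ⟨k, hkA, hk1, hk2⟩ := hA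
    have hkA' : k ∉ A' := fun h => h4 k h ⟨hk1, hk2⟩
    exact ⟨(ρ k, 1), Or.inl (Or.inr ⟨k, ⟨hkA, hkA'⟩, rfl⟩), hk1.le, hk2.le, fun _ => hk2, fun h => by omega⟩
  have hB : ¬∀ k ∈ B, ¬(ρ p.1 < γ k ∧ γ k < γ p.2) := fun hB => hp (mem_patt.2 ⟨ha, hb, h3, hA, hB⟩)
  push Not at hB
  obtain ⟨k, hkB, hk1, hk2⟩ := hB
  have hkB' : k ∉ B' := fun h => h5 k h ⟨hk1, hk2⟩
  exact ⟨(γ k, 3), Or.inr (Or.inr ⟨k, ⟨hkB, hkB'⟩, rfl⟩), hk1.le, hk2.le, fun h => by omega, fun _ => hk1⟩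

/-- Distinct pattern pairs own disjoint sets of events. [folklore] -/
theorem eq_of_owns (hρ : Function.Injective ρ) (hγ : Function.Injective γ) {A : Finset ι} {B : Finset κ}
    {p p' : ι × κ} (hp : p ∈ patt ρ γ A B) (hp' : p' ∈ patt ρ γ A B) {e : ℕ × ℕ}
    (he : ρ p.1 ≤ e.1 ∧ e.1 ≤ γ p.2 ∧ (e.2 ≤ 1 → e.1 < γ p.2) ∧ (2 ≤ e.2 → ρ p.1 < e.1))
    (he' : ρ p'.1 ≤ e.1 ∧ e.1 ≤ γ p'.2 ∧ (e.2 ≤ 1 → e.1 < γ p'.2) ∧ (2 ≤ e.2 → ρ p'.1 < e.1)) : p = p' := by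
  by_contra hne
  obtain ⟨e1, e2, e3, e4⟩ := he
  obtain ⟨e1', e2', e3', e4'⟩ := he'
  rcases patt_sep hρ hγ hp hp' hne with k | k
  · by_cases ht : e.2 ≤ 1
    · have := e3 ht; omega
    · have := e4' (by omega); omega
  · by_cases ht : e.2 ≤ 1
    · have := e3' ht; omega
    · have := e4 (by omega); omega

/-- **New pattern pairs are at most as many as events.** [folklore] -/
theorem card_sdiff_patt_le [DecidableEq ι] [DecidableEq κ] (hρ : Function.Injective ρ)
    (hγ : Function.Injective γ) (A A' : Finset ι) (B B' : Finset κ) :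
    (patt ρ γ A' B' \ patt ρ γ A B).card ≤ (events ρ γ A A' B B').card := by
  have h : ∀ p ∈ patt ρ γ A' B' \ patt ρ γ A B, ∃ e ∈ events ρ γ A A' B B',
      ρ p.1 ≤ e.1 ∧ e.1 ≤ γ p.2 ∧ (e.2 ≤ 1 → e.1 < γ p.2) ∧ (2 ≤ e.2 → ρ p.1 < e.1) := fun p hp =>
    exists_event (Finset.mem_sdiff.1 hp).1 (Finset.mem_sdiff.1 hp).2
  choose! f hf hown using h
  exact Finset.card_le_card_of_injOn f (fun p hp => hf p hp) fun p hp p' hp' heq =>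
    eq_of_owns hρ hγ (Finset.mem_sdiff.1 (Finset.mem_coe.1 hp)).1 (Finset.mem_sdiff.1 (Finset.mem_coe.1 hp')).1
      (hown p (Finset.mem_coe.1 hp)) (by rw [heq]; exact hown p' (Finset.mem_coe.1 hp'))

end Pattern

/-! ### The sweep: label families that are intervals in time -/

section Sweep

/-- The sweep potential of a label family at time `t` with history `T`: a current label may still disappear (`1`), a
label never seen may still appear and then disappear (`2`), a label seen and gone is spent (`0`). -/
def pot {α : Type*} [DecidableEq α] (R : Finset α) (𝒜 : ℝ → Finset α) (T : Finset ℝ) (t : ℝ) : ℕ :=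
  ∑ k ∈ R, if k ∈ 𝒜 t then 1 else if ∀ u ∈ T, k ∉ 𝒜 u then 2 else 0

/-- One sweep step for one label family: the potential pays for the appearing and disappearing labels. [folklore] -/
theorem pot_step {α : Type*} [DecidableEq α] (R : Finset α) (𝒜 : ℝ → Finset α) (hsub : ∀ t, 𝒜 t ⊆ R)
    (hconv : ∀ k t₁ t₂ t₃, t₁ ≤ t₂ → t₂ ≤ t₃ → k ∈ 𝒜 t₁ → k ∈ 𝒜 t₃ → k ∈ 𝒜 t₂)
    {T : Finset ℝ} {t' t : ℝ} (ht'T : t' ∈ T) (hmax : ∀ u ∈ T, u ≤ t') (ht : t' < t) :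
    pot R 𝒜 (insert t T) t + ((𝒜 t \ 𝒜 t').card + (𝒜 t' \ 𝒜 t).card) ≤ pot R 𝒜 T t' := by
  have h1 : (𝒜 t \ 𝒜 t').card = ∑ k ∈ R, if k ∈ 𝒜 t ∧ k ∉ 𝒜 t' then 1 else 0 := by
    rw [← Finset.card_filter]
    congr 1; ext k
    simp only [Finset.mem_sdiff, Finset.mem_filter]
    exact ⟨fun h => ⟨hsub t h.1, h⟩, fun h => h.2⟩
  have h2 : (𝒜 t' \ 𝒜 t).card = ∑ k ∈ R, if k ∈ 𝒜 t' ∧ k ∉ 𝒜 t then 1 else 0 := by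
    rw [← Finset.card_filter]
    congr 1; ext k
    simp only [Finset.mem_sdiff, Finset.mem_filter]
    exact ⟨fun h => ⟨hsub t' h.1, h⟩, fun h => h.2⟩
  unfold pot
  rw [h1, h2, ← Finset.sum_add_distrib, ← Finset.sum_add_distrib]
  refine Finset.sum_le_sum fun k _ => ?_
  -- a label seen before `t'` and absent at `t'` stays absent (intervals in time)
  have hgone : (∃ u ∈ T, k ∈ 𝒜 u) → k ∉ 𝒜 t' → k ∉ 𝒜 t := by
    rintro ⟨u, huT, hku⟩ hk' hk
    rcases (hmax u huT).lt_or_eq with hlt | heq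
    · exact hk' (hconv k u t' t hlt.le ht.le hku hk)
    · exact hk' (heq ▸ hku)
  have htI : t ∈ insert t T := Finset.mem_insert_self t T
  have ht'I : t' ∈ insert t T := Finset.mem_insert_of_mem ht'T
  by_cases a' : k ∈ 𝒜 t'
  · -- a current label: it stays (`1 → 1`) or disappears (`1 → 0`, paying for the event)
    have hν' : ¬∀ u ∈ T, k ∉ 𝒜 u := fun h => h t' ht'T a'
    have hνn : ¬∀ u ∈ insert t T, k ∉ 𝒜 u := fun h => h t' ht'I a'
    have c3 : ¬(k ∈ 𝒜 t ∧ k ∉ 𝒜 t') := fun h => h.2 a'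
    rw [if_pos a', if_neg c3]
    by_cases a : k ∈ 𝒜 t
    · have c4 : ¬(k ∈ 𝒜 t' ∧ k ∉ 𝒜 t) := fun h => h.2 a
      rw [if_pos a, if_neg c4]; omega
    · rw [if_neg a, if_neg hνn, if_pos ⟨a', a⟩]; omega
  · have c4 : ¬(k ∈ 𝒜 t' ∧ k ∉ 𝒜 t) := fun h => a' h.1
    rw [if_neg a', if_neg c4]
    by_cases ν : ∀ u ∈ T, k ∉ 𝒜 u
    · -- a label never seen: it appears now (2 → 1 + event) or stays unseen (2 → 2)
      rw [if_pos ν]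
      by_cases a : k ∈ 𝒜 t
      · have hνn : ¬∀ u ∈ insert t T, k ∉ 𝒜 u := fun h => h t htI a
        rw [if_pos a, if_pos ⟨a, a'⟩]; omega
      · have hνn : ∀ u ∈ insert t T, k ∉ 𝒜 u := by
          intro u hu
          rcases Finset.mem_insert.1 hu with rfl | hu
          · exact a
          · exact ν u hu
        have c3 : ¬(k ∈ 𝒜 t ∧ k ∉ 𝒜 t') := fun h => a h.1
        rw [if_neg a, if_pos hνn, if_neg c3]; omega
    · -- a spent label stays spent (intervals in time)
      rw [if_neg ν]
      push Not at ν
      have a : k ∉ 𝒜 t := hgone ν a'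
      have hνn : ¬∀ u ∈ insert t T, k ∉ 𝒜 u := by
        obtain ⟨u, hu, hku⟩ := ν
        exact fun h => h u (Finset.mem_insert_of_mem hu) hku
      have c3 : ¬(k ∈ 𝒜 t ∧ k ∉ 𝒜 t') := fun h => a h.1
      rw [if_neg a, if_neg hνn, if_neg c3]; omega

/-- **The sweep bound.** If every row's and every column's membership in the label families is an interval of times, then
over any finite set of times at most `2·(#R + #C)` pattern pairs are ever formed. [folklore] -/
theorem card_biUnion_patt_le [DecidableEq ι] [DecidableEq κ] (hρ : Function.Injective ρ) (hγ : Function.Injective γ)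
    {R : Finset ι} {C : Finset κ} {𝒜 : ℝ → Finset ι} {ℬ : ℝ → Finset κ} (hA : ∀ t, 𝒜 t ⊆ R) (hB : ∀ t, ℬ t ⊆ C)
    (hAc : ∀ k t₁ t₂ t₃, t₁ ≤ t₂ → t₂ ≤ t₃ → k ∈ 𝒜 t₁ → k ∈ 𝒜 t₃ → k ∈ 𝒜 t₂)
    (hBc : ∀ k t₁ t₂ t₃, t₁ ≤ t₂ → t₂ ≤ t₃ → k ∈ ℬ t₁ → k ∈ ℬ t₃ → k ∈ ℬ t₂) (T : Finset ℝ) :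
    (T.biUnion fun t => patt ρ γ (𝒜 t) (ℬ t)).card ≤ 2 * (R.card + C.card) := by
  -- invariant along `Finset.induction_on_max`: pairs formed + potential ≤ 2(#R + #C)
  suffices h : ∀ hT : T.Nonempty,
      (T.biUnion fun t => patt ρ γ (𝒜 t) (ℬ t)).card + (pot R 𝒜 T (T.max' hT) + pot C ℬ T (T.max' hT)) ≤
        2 * (R.card + C.card) by
    rcases T.eq_empty_or_nonempty with rfl | hT
    · simp
    · have := h hT; omega
  induction T using Finset.induction_on_max with
  | empty => intro hT; exact absurd rfl hT.ne_empty
  | insert t s hlt ih =>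
    intro hT
    -- the new maximum is `t`
    have hmx : (insert t s).max' hT = t := by
      refine le_antisymm (Finset.max'_le _ hT _ fun u hu => ?_) (Finset.le_max' _ _ (Finset.mem_insert_self t s))
      rcases Finset.mem_insert.1 hu with rfl | hu
      · exact le_rfl
      · exact (hlt u hu).le
    rw [hmx]
    rcases s.eq_empty_or_nonempty with rfl | hs
    · -- a single time: `#patt ≤ #𝒜 t`, potential `= (2#R - #𝒜 t) + (2#C - #ℬ t)`
      rw [Finset.insert_empty, Finset.singleton_biUnion]
      have hp := card_patt_le hρ hγ (𝒜 t) (ℬ t)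
      have hpot : pot R 𝒜 {t} t + (𝒜 t).card = 2 * R.card := by
        unfold pot
        have hc : (𝒜 t).card = ∑ k ∈ R, if k ∈ 𝒜 t then 1 else 0 := by
          rw [← Finset.card_filter]; congr 1; ext k; simp only [Finset.mem_filter]
          exact ⟨fun h => ⟨hA t h, h⟩, fun h => h.2⟩
        rw [hc, ← Finset.sum_add_distrib, Finset.card_eq_sum_ones, Finset.mul_sum]
        refine Finset.sum_congr rfl fun k _ => ?_
        by_cases h : k ∈ 𝒜 t <;> simp [h]
      have hpC : pot C ℬ {t} t ≤ 2 * C.card := by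
        unfold pot
        rw [Finset.card_eq_sum_ones, Finset.mul_sum]
        refine Finset.sum_le_sum fun k _ => ?_
        by_cases h : k ∈ ℬ t <;> simp [h]
      omega
    · -- `s` nonempty with maximum `t'`
      set t' := s.max' hs with ht'
      have ht's : t' ∈ s := Finset.max'_mem s hs
      have hmax' : ∀ u ∈ s, u ≤ t' := fun u hu => Finset.le_max' s u hu
      have htt' : t' < t := hlt t' ht's
      have ihs := ih hs
      rw [← ht'] at ihs
      -- the new pairs are new with respect to time `t'`
      have hU : ((insert t s).biUnion fun t => patt ρ γ (𝒜 t) (ℬ t)).card ≤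
          (s.biUnion fun t => patt ρ γ (𝒜 t) (ℬ t)).card +
            (patt ρ γ (𝒜 t) (ℬ t) \ patt ρ γ (𝒜 t') (ℬ t')).card := by
        rw [Finset.biUnion_insert]
        calc (patt ρ γ (𝒜 t) (ℬ t) ∪ s.biUnion fun t => patt ρ γ (𝒜 t) (ℬ t)).card
            ≤ ((s.biUnion fun t => patt ρ γ (𝒜 t) (ℬ t)) ∪
                (patt ρ γ (𝒜 t) (ℬ t) \ patt ρ γ (𝒜 t') (ℬ t'))).card := by
              refine Finset.card_le_card fun p hp => ?_
              rw [Finset.mem_union] at hp ⊢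
              rcases hp with hp | hp
              · by_cases hq : p ∈ patt ρ γ (𝒜 t') (ℬ t')
                · exact Or.inl (Finset.mem_biUnion.2 ⟨t', ht's, hq⟩)
                · exact Or.inr (Finset.mem_sdiff.2 ⟨hp, hq⟩)
              · exact Or.inl hp
          _ ≤ _ := Finset.card_union_le _ _
      have hnew := (card_sdiff_patt_le hρ hγ (𝒜 t') (𝒜 t) (ℬ t') (ℬ t)).trans
        (card_events_le (𝒜 t') (𝒜 t) (ℬ t') (ℬ t))
      have hrow := pot_step R 𝒜 hA hAc ht's hmax' htt'
      have hcol := pot_step C ℬ hB hBc ht's hmax' htt'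
      omega

end Sweep

end Stair

end TotalsLaw

end Summit.ValiantsHypothesis.ValiantsHypothesis.Theorems.NewtonUnitEquationsDissociatedUniform
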